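import Summits.QuantumFields.YangMills.Theorems.IR.DefectChainPriceDefs
import Summits.QuantumFields.YangMills.Theorems.IR.DefectChainRarityCount
import Summits.QuantumFields.YangMills.Theorems.BalabanLadderIROddTorusLargeFieldRaritySharp
import Mathlib.Analysis.SpecialFunctions.Pow.Continuity
import Mathlib.Analysis.SpecialFunctions.Log.Basic
import HarnessLib

/-!
# Crux `IR` (stmt-QuantumFields-19354) — support stub S1 `ChainRarity` of the withdrawn line `defect-chain-price`
# (ym-ir-idea-3) PROVED: hereditary chessboard–Peierls rarity of bad boxes at the correlation scale

Helper module for item `stmt-QuantumFields-19354` (`--supports … --as helper`; it closes nothing).  Pooled prover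
ym-ir-line-pool-p3 (g13).  The line `defect-chain-price` (`Cruxes/IR/Lines/defect_chain_price.lean`) was STRUCK as typed
(its load S2 `PricedClustering` is crux-equivalent) and withdrawn with «no mechanism; bank the engine (S1 `ChainRarity`, S3
`DominationEngine`)» (idea-3 → director, 2026-08-27T23:59:58Z; census §L row 1).  S3 is `Theorems/IR/
DefectChainDominationEngine.lean` (p636154).  This file banks S1 over the tree vocabulary `Theorems/IR/DefectChainPriceDefs.lean`:

* `chainRarity_holds : ChainRarity` — for every compact simple `G`, lattice representation `r`, unit `a → 0⁺` and `θ > 0`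
  there is `p(β) → 0`, `p ≥ 0`, with `μ_{2S+1,β}{all boxes j ∈ F bad} ≤ p(β)^{#F}` for every `β`, every torus `2S+1` with
  `m·ℓ(β) ≤ S` and every `F ⊆ range m` (bad box = a defect chain of `k(β)+1 = ⌈log(1/a(β))⌉+1` plaquettes of Wilson cost
  `≥ 1` starts in the `j`-th box of side `ℓ(β) = ⌈θ/a(β)⌉` of the time-axis tube).

Proof (Peierls–chessboard, as the card predicted; no new fact).  (1) CHESSBOARD: the tree's hereditary large-field rarity
for every lattice representation, SHARP rate (`OddTorusChessboard.measureReal_forall_le_cellAction_le_pow_rep_sharp`,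
Fröhlich–Israel–Lieb–Simon 1978 Thm 4.1 on the odd torus), with cells = whole chains (`n = T = k+1`, `λ = β`): pairwise
disjoint chains `P_i` cost `μ{∀ i ∈ F, k+1 ≤ ∑_{q ∈ P_i} φ_q} ≤ δ(β)^{(k+1)#F}`, `δ(β) = exp((−β + K₀ + D₁ log β)/m)`, `m = 6`.
(2) DISJOINTNESS (`DefectChainRarityCount`): boxes of the same residue class mod `3` are `≥ 2ℓ+1 > 4k` apart in time once
`2k ≤ ℓ`, so their chains are disjoint; pigeonhole keeps a residue class `F_r` with `3#F_r ≥ #F`.  (3) UNION BOUND over the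
`≤ (8ℓ⁴m(625m)^k)^{#F_r}` assignments of chains (`Finset.pi`; `exists_chainFinset`): `μ ≤ q^{#F_r}`, `q = 8ℓ⁴m(625m)^k δ^{k+1}`,
hence `≤ p^{#F}` with `p = q^{1/3}` (both when `q ≤ 1` and, trivially, when `q > 1`); `p := 1` where `β < 1` or `2k > ℓ`.
(4) ASYMPTOTICS: `1/a → ∞` and `log = o(id)` give `2k ≤ ℓ` eventually and `ℓ ≤ (θ+1)e^k`, so
`q ≤ 8m(θ+1)⁴ (625 m e⁴ δ)^k δ ≤ 8m(θ+1)⁴ δ → 0`.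

HONEST FRAMING.  A large-field ∕ defect-chain rarity estimate at the correlation scale, group-blind (uses only `β → ∞` through the
chessboard free-energy constant); it prices nothing by itself — the line's load S2 is crux-equivalent and OPEN.  Nothing here bears on
`BalabanLadder.IR` (0/1), confinement, a lattice gap or the Yang–Mills mass gap (Clay), which are NOT proved; `R4` closes only the
conditional finite-𝕋⁴ rung `BalabanLadder.UV`.
-/

set_option autoImplicit false

noncomputable section

open MeasureTheory Filter Topology Finset
open Literature.MathematicalPhysics.QuantumFieldTheory
open Summit.QuantumFields.YangMills.Theorems.OddTorusChessboard (Orient measureReal_forall_le_cellAction_le_pow_rep_sharp)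

namespace Summit.QuantumFields.YangMills.Cruxes.IR.DefectChain

/-! ## §1 The cost cell of an injective defect chain -/

section Elementary

variable {L : ℕ} {G : Type*} [Group G] {N : ℕ}

/-- Along an injective chain of `k+1` plaquettes each of Wilson cost `≥ 1`, the cell `image c` carries total cost `≥ k+1`. -/
theorem succ_le_sum_cost_image (ρ : G →* Matrix (Fin N) (Fin N) ℂ) (U : GaugeConfig 4 L G) {k : ℕ}
    (c : Fin (k + 1) → Plaquette 4 L) (hinj : Function.Injective c)
    (hcost : ∀ i, (1 : ℝ) ≤ plaquetteCost ρ U (c i)) :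
    ((k + 1 : ℕ) : ℝ) ≤ ∑ q ∈ univ.image c, plaquetteCost ρ U q := by
  classical
  rw [Finset.sum_image fun i _ j _ h => hinj h]
  calc ((k + 1 : ℕ) : ℝ) = ∑ _i : Fin (k + 1), (1 : ℝ) := by simp
    _ ≤ ∑ i : Fin (k + 1), plaquetteCost ρ U (c i) := Finset.sum_le_sum fun i _ => hcost i

/-- The cell of a chain of `k+1` plaquettes has at most `k+1` plaquettes. -/
theorem card_image_chain_le {k : ℕ} (c : Fin (k + 1) → Plaquette 4 L) : #(univ.image c) ≤ k + 1 :=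
  Finset.card_image_le.trans (by simp)

end Elementary

/-! ## §2 The union bound at fixed `β` for one residue class of boxes -/

section Core

variable {G : Type} [Group G] [TopologicalSpace G] [IsTopologicalGroup G] [CompactSpace G]
  [MeasurableSpace G] [BorelSpace G]

/-- **The union bound.**  On the torus `2S+1` with `m ℓ ≤ S`, `2k ≤ ℓ`, for a family `F ⊆ range m` of boxes of ONE residue
class mod `3`: if the Wilson measure charges every family of pairwise disjoint cells `P_i` (`i ∈ F`, `#P_i ≤ k+1`) of total
cost `≥ k+1` each by at most `δk^{#F}` (the chessboard input), then
`μ{all boxes of F bad} ≤ (8ℓ⁴m(625m)^k · δk)^{#F}` — union over the assignments of one chain per box (`Finset.pi` of the chain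
sets of `exists_chainFinset`), chains of distinct boxes of the class being disjoint (`disjoint_image_chains`). -/
theorem measureReal_badBoxes_le_of_chessboard (r : LatticeRep G) (β : ℝ) {S m ℓ k : ℕ}
    (hmS : m * ℓ ≤ S) (hkℓ : 2 * k ≤ ℓ) (F : Finset ℕ) (hF : F ⊆ Finset.range m)
    (res : ℕ) (hres : ∀ j ∈ F, j % 3 = res) {δk : ℝ} (hδk : 0 ≤ δk)
    (hCB : ∀ (P : ℕ → Finset (Plaquette 4 (2 * S + 1))),
      (∀ i ∈ F, ∀ j ∈ F, i ≠ j → Disjoint (P i) (P j)) → (∀ i ∈ F, #(P i) ≤ k + 1) →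
      (wilsonMeasure (d := 4) (L := 2 * S + 1) r.ρ β).real
          {U | ∀ i ∈ F, ((k + 1 : ℕ) : ℝ) ≤ ∑ q ∈ P i, plaquetteCost r.ρ U q} ≤ δk ^ #F) :
    (wilsonMeasure (d := 4) (L := 2 * S + 1) r.ρ β).real {U | ∀ j ∈ F, U ∈ badBox r.ρ k ℓ j} ≤
      (((8 * ℓ ^ 4 * Fintype.card (Orient 4) * (625 * Fintype.card (Orient 4)) ^ k : ℕ) : ℝ) * δk) ^ #F := by
  classical
  set μ := wilsonMeasure (d := 4) (L := 2 * S + 1) r.ρ β with hμ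
  haveI : IsProbabilityMeasure μ :=
    isProbabilityMeasure_wilsonMeasure (d := 4) (L := 2 * S + 1) (G := G) r.ρ r.continuous β
  set M : ℕ := Fintype.card (Orient 4) with hM
  set Nc : ℕ := 8 * ℓ ^ 4 * M * (625 * M) ^ k with hNc
  -- the finite sets of admissible chains, box by box
  have hT := fun j : ℕ => exists_chainFinset (L := 2 * S + 1) k ℓ j
  choose T hTmem hTcard using hT
  -- the events «the assigned chains are all charged»
  set A : (∀ j ∈ F, Fin (k + 1) → Plaquette 4 (2 * S + 1)) → Set (GaugeConfig 4 (2 * S + 1) G) :=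
    fun σ => {U | ∀ (j : ℕ) (h : j ∈ F) (i : Fin (k + 1)), (1 : ℝ) ≤ plaquetteCost r.ρ U (σ j h i)} with hA
  -- (a) cover: a configuration with all boxes of `F` bad has an admissible charged chain in each box
  have hcover : {U : GaugeConfig 4 (2 * S + 1) G | ∀ j ∈ F, U ∈ badBox r.ρ k ℓ j} ⊆ ⋃ σ ∈ F.pi T, A σ := by
    intro U hU
    simp only [Set.mem_setOf_eq] at hU
    have hch : ∀ (j : ℕ) (h : j ∈ F), ∃ c : Fin (k + 1) → Plaquette 4 (2 * S + 1),
        c ∈ T j ∧ ∀ i, (1 : ℝ) ≤ plaquetteCost r.ρ U (c i) := by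
      intro j h
      have hj := hU j h
      simp only [badBox, Set.mem_setOf_eq, HasDefectChain] at hj
      obtain ⟨c, hinj, h0, hstep, hcost⟩ := hj
      exact ⟨c, (hTmem j c).2 ⟨hinj, h0, hstep⟩, hcost⟩
    choose σ hσT hσcost using hch
    exact Set.mem_iUnion₂.2 ⟨σ, Finset.mem_pi.2 fun j h => hσT j h, fun j h i => hσcost j h i⟩
  -- (b) each event is charged at most `δk ^ #F` by the chessboard input
  have hAle : ∀ σ ∈ F.pi T, μ.real (A σ) ≤ δk ^ #F := by
    intro σ hσ
    rw [Finset.mem_pi] at hσ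
    set P : ℕ → Finset (Plaquette 4 (2 * S + 1)) := fun j => if h : j ∈ F then univ.image (σ j h) else ∅ with hP
    have hPj : ∀ (j : ℕ) (h : j ∈ F), P j = univ.image (σ j h) := fun j h => by simp [hP, h]
    have hprop : ∀ (j : ℕ) (h : j ∈ F), Function.Injective (σ j h) ∧ (σ j h 0).1 ∈ tubeBox (2 * S + 1) ℓ j ∧
        ∀ i : Fin k, siteDist (σ j h i.castSucc).1 (σ j h i.succ).1 ≤ 2 := fun j h => (hTmem j _).1 (hσ j h)
    have hdisj : ∀ i ∈ F, ∀ j ∈ F, i ≠ j → Disjoint (P i) (P j) := by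
      intro i hi j hj hij
      rw [hPj i hi, hPj j hj]
      obtain ⟨-, hi0, histep⟩ := hprop i hi
      obtain ⟨-, hj0, hjstep⟩ := hprop j hj
      exact disjoint_image_chains hmS hkℓ (Finset.mem_range.1 (hF hi)) (Finset.mem_range.1 (hF hj)) hij
        ((hres i hi).trans (hres j hj).symm) hi0 histep hj0 hjstep
    have hcard : ∀ i ∈ F, #(P i) ≤ k + 1 := fun i hi => by
      rw [hPj i hi]
      exact card_image_chain_le _
    have hsub : A σ ⊆ {U | ∀ i ∈ F, ((k + 1 : ℕ) : ℝ) ≤ ∑ q ∈ P i, plaquetteCost r.ρ U q} := by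
      intro U hU i hi
      simp only [hA, Set.mem_setOf_eq] at hU
      rw [hPj i hi]
      exact succ_le_sum_cost_image r.ρ U (σ i hi) (hprop i hi).1 (hU i hi)
    exact (measureReal_mono hsub).trans (hCB P hdisj hcard)
  -- (c) counting the assignments
  have hpi : (#(F.pi T) : ℝ) ≤ (Nc : ℝ) ^ #F := by
    have h : #(F.pi T) ≤ Nc ^ #F := by
      rw [Finset.card_pi]
      exact Finset.prod_le_pow_card _ _ _ fun j _ => hTcard j
    exact_mod_cast h
  -- (d) assemble
  calc μ.real {U | ∀ j ∈ F, U ∈ badBox r.ρ k ℓ j}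
      ≤ μ.real (⋃ σ ∈ F.pi T, A σ) := measureReal_mono hcover (measure_ne_top μ _)
    _ ≤ ∑ σ ∈ F.pi T, μ.real (A σ) := measureReal_biUnion_finset_le _ _
    _ ≤ ∑ σ ∈ F.pi T, δk ^ #F := Finset.sum_le_sum hAle
    _ = #(F.pi T) * δk ^ #F := by rw [Finset.sum_const, nsmul_eq_mul]
    _ ≤ (Nc : ℝ) ^ #F * δk ^ #F := by gcongr
    _ = ((Nc : ℝ) * δk) ^ #F := (mul_pow _ _ _).symm

end Core

/-! ## §3 S1 `ChainRarity` -/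

/-- **S1 `ChainRarity` (support stub of the withdrawn line `defect-chain-price`) — PROVED: hereditary chessboard–Peierls
rarity of bad boxes at the correlation scale.**  For every compact simple `G`, lattice representation `r`, unit `a → 0⁺`
and `θ > 0` there is `p(β) → 0`, `p ≥ 0`, such that for every `β`, every torus `2S+1` with `m·⌈θ/a(β)⌉ ≤ S` and every
`F ⊆ range m`: `μ_{2S+1,β}{∀ j ∈ F, box j is bad} ≤ p(β)^{#F}`. -/
theorem chainRarity_holds : ChainRarity := by
  intro G _ _ _ _ _hG
  letI : MeasurableSpace G := borel G
  haveI : BorelSpace G := ⟨rfl⟩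
  intro r a ha ha0 θ hθ
  classical
  obtain ⟨K₀, D₁, hCB⟩ := measureReal_forall_le_cellAction_le_pow_rep_sharp (G := G) r
  -- constants, the chessboard rate `δ`, the counting factor `Nc`, `q = Nc δ^{k+1}`, `p = q^{1/3}` (or `1`)
  set M : ℕ := Fintype.card (Orient 4) with hM
  have hMpos : 0 < M := Fintype.card_pos_iff.2 ⟨⟨((0 : Fin 4), (1 : Fin 4)), by decide⟩⟩
  have hM0 : (0 : ℝ) < M := by exact_mod_cast hMpos
  set δ : ℝ → ℝ := fun β => Real.exp ((-β + K₀ + D₁ * Real.log β) / M) with hδ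
  set Nc : ℝ → ℕ := fun β => 8 * scaleL a θ β ^ 4 * M * (625 * M) ^ chainK a β with hNc
  set q : ℝ → ℝ := fun β => (Nc β : ℝ) * δ β ^ (chainK a β + 1) with hq
  set p : ℝ → ℝ := fun β => if 1 ≤ β ∧ 2 * chainK a β ≤ scaleL a θ β then q β ^ (1 / 3 : ℝ) else 1 with hp
  have hδpos : ∀ β, 0 < δ β := fun β => Real.exp_pos _
  have hqnn : ∀ β, 0 ≤ q β := fun β => mul_nonneg (Nat.cast_nonneg _) (pow_nonneg (hδpos β).le _)
  have hpnn : ∀ β, 0 ≤ p β := by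
    intro β
    simp only [hp]
    split_ifs
    · exact Real.rpow_nonneg (hqnn β) _
    · exact zero_le_one
  refine ⟨p, ?_, hpnn, ?_⟩
  · /- ASYMPTOTICS: `p β → 0` -/
    -- (i) `1/a → ∞`
    have ha_within : Tendsto a atTop (𝓝[>] 0) :=
      tendsto_nhdsWithin_iff.2 ⟨ha0, Eventually.of_forall fun β => ha β⟩
    have hinv : Tendsto (fun β => (a β)⁻¹) atTop atTop := ha_within.inv_tendsto_nhdsGT_zero
    -- (ii) eventually `1 ≤ β` and `2k ≤ ℓ`
    have hcond : ∀ᶠ β in atTop, 1 ≤ β ∧ 2 * chainK a β ≤ scaleL a θ β := by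
      have h1 : ∀ᶠ β : ℝ in atTop, (1 : ℝ) ≤ β := eventually_ge_atTop 1
      have h2 : ∀ᶠ β in atTop, ‖Real.log ((a β)⁻¹)‖ ≤ θ / 4 * ‖(a β)⁻¹‖ :=
        hinv.eventually (Real.isLittleO_log_id_atTop.bound (by positivity))
      have h3 : ∀ᶠ β in atTop, 4 / θ ≤ (a β)⁻¹ := hinv.eventually (eventually_ge_atTop _)
      filter_upwards [h1, h2, h3] with β hβ hlog hge
      refine ⟨hβ, ?_⟩
      have hapos := ha β
      have hx : 0 < (a β)⁻¹ := inv_pos.2 hapos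
      rw [Real.norm_eq_abs, Real.norm_eq_abs, abs_of_pos hx] at hlog
      have hkb : ((chainK a β : ℕ) : ℝ) < |Real.log ((a β)⁻¹)| + 1 := by
        rw [chainK, one_div]
        exact natCeil_lt_abs_add_one _
      have hℓb : θ * (a β)⁻¹ ≤ (scaleL a θ β : ℝ) := by
        rw [scaleL, ← div_eq_mul_inv]
        exact Nat.le_ceil _
      have e1 : 2 * |Real.log ((a β)⁻¹)| ≤ θ * (a β)⁻¹ / 2 := by
        have := hlog
        linarith
      have e2 : (2 : ℝ) ≤ θ * (a β)⁻¹ / 2 := by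
        have h := mul_le_mul_of_nonneg_left hge (by positivity : (0 : ℝ) ≤ θ / 2)
        calc (2 : ℝ) = θ / 2 * (4 / θ) := by field_simp; ring
          _ ≤ θ / 2 * (a β)⁻¹ := h
          _ = θ * (a β)⁻¹ / 2 := by ring
      have h2k : ((2 * chainK a β : ℕ) : ℝ) < (scaleL a θ β : ℝ) := by
        push_cast
        linarith
      exact_mod_cast h2k.le
    -- (iii) `δ → 0`
    have hδ0 : Tendsto δ atTop (𝓝 0) := by
      rw [hδ]
      refine Real.tendsto_exp_comp_nhds_zero.2 ?_
      have hlog : ∀ᶠ β : ℝ in atTop, ‖Real.log β‖ ≤ 1 / (2 * (D₁ + 1)) * ‖β‖ :=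
        Real.isLittleO_log_id_atTop.bound (by positivity)
      have hlin : Tendsto (fun β : ℝ => (-β / 2 + K₀) / M) atTop atBot := by
        refine Tendsto.atBot_div_const hM0 ?_
        refine tendsto_atBot_add_const_right _ _ ?_
        exact tendsto_neg_atTop_atBot.atBot_div_const (by norm_num)
      refine tendsto_atBot_mono' atTop ?_ hlin
      filter_upwards [hlog, eventually_ge_atTop (0 : ℝ)] with β hβlog hβ0
      rw [Real.norm_eq_abs, Real.norm_eq_abs, abs_of_nonneg hβ0] at hβlog
      have hD1 : (0 : ℝ) ≤ D₁ := Nat.cast_nonneg _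
      have hD : (D₁ : ℝ) * Real.log β ≤ β / 2 := by
        calc (D₁ : ℝ) * Real.log β ≤ D₁ * |Real.log β| := by gcongr; exact le_abs_self _
          _ ≤ D₁ * (1 / (2 * (D₁ + 1)) * β) := by gcongr
          _ = D₁ / (D₁ + 1) * (β / 2) := by field_simp
          _ ≤ 1 * (β / 2) := by
              gcongr
              rw [div_le_one (by positivity)]
              linarith
          _ = β / 2 := one_mul _
      exact div_le_div_of_nonneg_right (by linarith) hM0.le
    -- (iv) eventually `q ≤ C δ`, `C = 8 M (θ+1)^4`
    set C : ℝ := 8 * M * (θ + 1) ^ 4 with hC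
    have hq_le : ∀ᶠ β in atTop, q β ≤ C * δ β := by
      have hsmall : ∀ᶠ β in atTop, δ β ≤ 1 / (625 * M * Real.exp 4) :=
        hδ0.eventually (eventually_le_nhds (by positivity))
      filter_upwards [hsmall] with β hβδ
      have hapos := ha β
      have hek : (a β)⁻¹ ≤ Real.exp (chainK a β) := by
        have h1 : Real.log ((a β)⁻¹) ≤ (chainK a β : ℝ) := by
          simp only [chainK, one_div]
          exact Nat.le_ceil _
        calc (a β)⁻¹ = Real.exp (Real.log (a β)⁻¹) := (Real.exp_log (inv_pos.2 hapos)).symm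
          _ ≤ Real.exp (chainK a β) := Real.exp_le_exp.2 h1
      have hℓ : (scaleL a θ β : ℝ) ≤ (θ + 1) * Real.exp (chainK a β) := by
        have h1 : (scaleL a θ β : ℝ) < θ / a β + 1 := Nat.ceil_lt_add_one (by positivity)
        have h2 : θ / a β ≤ θ * Real.exp (chainK a β) := by
          rw [div_eq_mul_inv]
          exact mul_le_mul_of_nonneg_left hek hθ.le
        have h3 : (1 : ℝ) ≤ Real.exp (chainK a β) := Real.one_le_exp (Nat.cast_nonneg _)
        nlinarith
      have hexp : Real.exp (chainK a β : ℝ) ^ 4 = Real.exp 4 ^ chainK a β := by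
        rw [← Real.exp_nat_mul, ← Real.exp_nat_mul]
        ring_nf
      have hone : 625 * (M : ℝ) * Real.exp 4 * δ β ≤ 1 := by
        have := (le_div_iff₀ (by positivity : (0 : ℝ) < 625 * M * Real.exp 4)).1 hβδ
        linarith
      have hδβ := (hδpos β).le
      calc q β = 8 * (scaleL a θ β : ℝ) ^ 4 * M * (625 * M) ^ chainK a β * δ β ^ (chainK a β + 1) := by
            simp only [hq, hNc]
            push_cast
            ring
        _ ≤ 8 * ((θ + 1) * Real.exp (chainK a β)) ^ 4 * M * (625 * M) ^ chainK a β *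
              δ β ^ (chainK a β + 1) := by gcongr
        _ = C * (625 * M * Real.exp 4 * δ β) ^ chainK a β * δ β := by
            rw [hC, mul_pow, hexp]
            ring
        _ ≤ C * 1 ^ chainK a β * δ β := by
            gcongr
        _ = C * δ β := by ring
    -- (v) conclude
    have hq0 : Tendsto q atTop (𝓝 0) := by
      have hC0 : Tendsto (fun β => C * δ β) atTop (𝓝 0) := by simpa using hδ0.const_mul C
      exact tendsto_of_tendsto_of_tendsto_of_le_of_le' tendsto_const_nhds hC0 (Eventually.of_forall hqnn) hq_le
    have hq3 : Tendsto (fun β => q β ^ (1 / 3 : ℝ)) atTop (𝓝 0) := hq0.rpow_const_nhds_zero (by norm_num)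
    refine hq3.congr' ?_
    filter_upwards [hcond] with β hβ
    simp only [hp]
    rw [if_pos hβ]
  · /- THE HEREDITARY BOUND at fixed `β`, `S`, `m`, `F` -/
    intro β S m hmS F hF
    set ℓ := scaleL a θ β with hℓ
    set k := chainK a β with hk
    set μ := wilsonMeasure (d := 4) (L := 2 * S + 1) r.ρ β with hμ
    haveI : IsProbabilityMeasure μ :=
      isProbabilityMeasure_wilsonMeasure (d := 4) (L := 2 * S + 1) (G := G) r.ρ r.continuous β
    have hμ1 : μ.real {U | ∀ j ∈ F, U ∈ badBox r.ρ k ℓ j} ≤ 1 := measureReal_le_one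
    have hℓpos : 0 < ℓ := Nat.ceil_pos.2 (div_pos hθ (ha β))
    by_cases hcond : 1 ≤ β ∧ 2 * k ≤ ℓ
    swap
    · -- trivial branch: `p β = 1`
      have hp1 : p β = 1 := by simp only [hp]; rw [if_neg hcond]
      rw [hp1, one_pow]
      exact hμ1
    obtain ⟨hβ, hkℓ⟩ := hcond
    have hpq : p β = q β ^ (1 / 3 : ℝ) := by simp only [hp]; rw [if_pos ⟨hβ, hkℓ⟩]
    -- the one-point torus: `S = 0` forces `m = 0`, `F = ∅`
    rcases Nat.eq_zero_or_pos S with hS0 | hSpos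
    · have hm0 : m = 0 := by
        rcases Nat.eq_zero_or_pos m with h | h
        · exact h
        · exfalso
          have : 1 * 1 ≤ m * ℓ := Nat.mul_le_mul h hℓpos
          omega
      subst hm0
      have hF0 : F = ∅ := Finset.subset_empty.1 (by simpa using hF)
      subst hF0
      simp only [Finset.card_empty, pow_zero]
      exact hμ1
    -- a residue class carrying a third of `F`
    obtain ⟨res, hres⟩ := card_le_three_mul_residue F
    set Fr := F.filter fun j => j % 3 = res with hFr
    have hFrF : Fr ⊆ F := Finset.filter_subset _ _
    have hmono : μ.real {U | ∀ j ∈ F, U ∈ badBox r.ρ k ℓ j} ≤ μ.real {U | ∀ j ∈ Fr, U ∈ badBox r.ρ k ℓ j} :=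
      measureReal_mono fun U hU j hj => hU j (hFrF hj)
    -- the chessboard input for the class `Fr`: cells = chains, `n = T = k+1`, `λ = β`
    have hL3 : 3 ≤ 2 * S + 1 := by omega
    have hodd : Odd (2 * S + 1) := odd_two_mul_add_one S
    have hCBr : ∀ (P : ℕ → Finset (Plaquette 4 (2 * S + 1))),
        (∀ i ∈ Fr, ∀ j ∈ Fr, i ≠ j → Disjoint (P i) (P j)) → (∀ i ∈ Fr, #(P i) ≤ k + 1) →
        μ.real {U | ∀ i ∈ Fr, ((k + 1 : ℕ) : ℝ) ≤ ∑ q ∈ P i, plaquetteCost r.ρ U q} ≤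
          (δ β ^ (k + 1)) ^ #Fr := by
      intro P hdisj hcard
      have h := hCB (L := 2 * S + 1) hodd hL3 β hβ β (by linarith) le_rfl Fr P hdisj (k + 1) hcard
        ((k + 1 : ℕ) : ℝ)
      refine h.trans_eq ?_
      congr 1
      rw [hδ]
      dsimp only
      rw [← Real.exp_nat_mul]
      congr 1
      field_simp
      ring
    have hcore := measureReal_badBoxes_le_of_chessboard r β hmS hkℓ Fr (hFrF.trans hF) res
      (fun j hj => (Finset.mem_filter.1 hj).2) (pow_nonneg (hδpos β).le (k + 1)) hCBr
    have hqeq : (((8 * ℓ ^ 4 * Fintype.card (Orient 4) * (625 * Fintype.card (Orient 4)) ^ k : ℕ) : ℝ) *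
        δ β ^ (k + 1)) = q β := by
      simp only [hq, hNc, hℓ, hk, hM]
    have hqFr : μ.real {U | ∀ j ∈ F, U ∈ badBox r.ρ k ℓ j} ≤ q β ^ #Fr := by
      rw [← hqeq]
      exact hmono.trans hcore
    have hqpos : 0 < q β := by
      have h1 : 0 < (Nc β : ℝ) := by
        have : 0 < 8 * ℓ ^ 4 * M * (625 * M) ^ k := by positivity
        simp only [hNc]
        exact_mod_cast this
      exact mul_pos h1 (pow_pos (hδpos β) _)
    rw [hpq]
    rcases le_or_gt (q β) 1 with hq1 | hq1
    · -- `q ≤ 1`: `q^{#Fr} ≤ q^{#F/3} = (q^{1/3})^{#F}`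
      have hexp : (#F : ℝ) / 3 ≤ ((#Fr : ℕ) : ℝ) := by
        rw [div_le_iff₀ (by norm_num : (0 : ℝ) < 3)]
        exact_mod_cast (by omega : #F ≤ #Fr * 3)
      calc μ.real {U | ∀ j ∈ F, U ∈ badBox r.ρ k ℓ j} ≤ q β ^ #Fr := hqFr
        _ = q β ^ ((#Fr : ℕ) : ℝ) := (Real.rpow_natCast _ _).symm
        _ ≤ q β ^ ((#F : ℝ) / 3) := Real.rpow_le_rpow_of_exponent_ge hqpos hq1 hexp
        _ = (q β ^ (1 / 3 : ℝ)) ^ #F := by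
            rw [← Real.rpow_natCast, ← Real.rpow_mul (hqnn β)]
            congr 1
            ring
    · -- `q > 1`: the bound is trivial
      have h1 : (1 : ℝ) ≤ (q β ^ (1 / 3 : ℝ)) ^ #F := one_le_pow₀ (Real.one_le_rpow hq1.le (by norm_num))
      exact hμ1.trans h1

end Summit.QuantumFields.YangMills.Cruxes.IR.DefectChain

end
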